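import Mathlib
import Summits.Ventures.HodgeRepro2.Tier7.Line3.KappaDataArch
import Summits.Ventures.HodgeRepro2.Tier7.Line3.KappaDataFinSplit

/-!
# Tier7/Line3/KappaDataOfAdapted — `KappaData` FROM THE ADAPTED MATRICES AND THE PLACE DATA (seat t7-x1, gen 2; the
composition offered at STATUS l. 15382 and accepted by L1-p5 at l. 15388)

`KappaData` (DominantSideOfKappa, p677612) is the κ-dictionary as displayed fields over an abstract set of double
cosets with `κ : Orb → K`. L1-p5's `KappaDataArch` (p679862) derives its ARCHIMEDEAN fields (`one_le_κ`, `hT`, the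
decays `ha₂ / ha₃`) and `KappaDataFin` (p680814) / `KappaDataFinSplit` (p681825) its FINITE fields (`hcong / hS / hout`) from the ADAPTED PAIR of
p1's `T7SupportTwoTorusInvariant` — a family of isometries `matO γ` of the hermitian plane over `E` with the global
invariant `κF γ ∈ K` (`algebraMap K E (κF γ) = kappa σ d f (matO γ)`, L1-p5's `KappaDescent`) — and the DATA OF EACH
PLACE: at an infinite place `w` an extension `ψ w : E →+* ℂ` of `w.embedding` intertwining the involutions with the
signature data (`Sig11Data` at the two rank-one places, `Sig20Data` at every other place), at a finite place `w` the
TWO absolute values `abv w`, `abv′ w` of `E` above `w`, conjugate under the involution (`abv w (σ x) = abv′ w x`; equal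
when `w` does not split in `E` — crit-2's objection (E), l. 15393, and L1-p5's `KappaDataFinSplit`), with the
integrality / boundedness / level-`N` congruence clauses of the matrices on the support at both. This module composes
them into ONE constructor:

  `structure AdaptedData` (the adapted pair, the place data, the support clauses, the finite factors and the spectral
  side — every field displayed) and
  `def kappaData (A : AdaptedData …) (ha_γ₀ …) (hident …) : KappaData K Rep Orb PA PB`,

in which every DICTIONARY field of `KappaData` — `hcong / hS / hout` (KappaDataFinSplit's field forms, which cover the
non-split places with `abv′ = abv`), `hT / one_le_κ₂ / one_le_κ₃ /
ha₂ / ha₃` (KappaDataArch; the archimedean factors `archFactor₂ / archFactor₃` are the model's two-torus orbital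
integrals at the representing pairs `rep₂ / rep₃ : Orb → SU11 × SU11` chosen from `exists_archFactor_decay_of_sig11`,
with p1's decay constant and exponent `k/2`, `k ≥ 3`) — is DERIVED; what remains displayed is the adapted pair with
its descent, the injectivity of `κF` (Orb = the regular double cosets: p1 rows 662/663), the place data (the §0
signatures), the support clauses on the matrices (what `f_N` is at each finite place), the compact-place factor
`a₁`, the finite factors `b` with `b_support / b_bound / b_γ₀`, the non-vanishing `a_γ₀` of the dominant archimedean
value (stated for the DEFINED factors) and the spectral side with the trace identity. Hence, through
`RealDominantOfKappa`, the residual of record reads at the level of the adapted MATRICES and the place data.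
NOTHING here proves any of those fields for the real objects (TYPING-CENSUS T7); nothing about (N) or HC_CM;
§8(d): NO. Blind lane: Mathlib + the HodgeRepro2 prefix only; no sorry; axioms ⊆ {propext, Classical.choice, Quot.sound}.
-/

namespace Summit.Ventures.HodgeRepro2.Tier7.Line3.KappaDataOfAdapted

open NumberField Matrix MeasureTheory Summit.Ventures.HodgeRepro2.T7SupportTwoTorusInvariant
  Summit.Ventures.HodgeRepro2.Tier7.Line3.KappaArchimedean
  Summit.Ventures.HodgeRepro2.Tier7.Line3.DominantSideOfKappa
  Summit.Ventures.HodgeRepro2.Tier7.Line3.KappaDataArch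
  Summit.Ventures.HodgeRepro2.Tier7.Line3.KappaDataFinSplit
open Summit.Ventures.HodgeRepro2.T5SU11Unimodular (SU11)
open Summit.Ventures.HodgeRepro2.T5BergmanCoefficient (mat act)
open Summit.Ventures.HodgeRepro2.T5SU11Fibration (rot)
open Summit.Ventures.HodgeRepro2.T5BergmanMatrixCoeff (matrixCoeff)
open Summit.Ventures.HodgeRepro2.T5HaarCircle (haarCircle)
open Summit.Ventures.HodgeRepro2.T5BergmanKTypeMatrix (decayConst)
open Summit.Ventures.HodgeRepro2.T5BergmanParseval (monomialNormSq)

/-- the model's two-torus orbital integral of the `K`-type `(j, n)` coefficient with the characters `(p, q)` at a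
representing pair `(γ′, h) ∈ SU11 × SU11` — the integrand of `KappaDataArch.exists_archFactor_decay_of_sig11`. -/
noncomputable def modelOrbital [MeasurableSpace Circle] (k j n : ℕ) (p q : ℤ) (rep : SU11 × SU11) : ℂ :=
  ∫ u : Circle, ∫ v : Circle,
    matrixCoeff k (act k rep.2 (fun w => w ^ j)) (fun w => w ^ n) (rot u * rep.1 * (rep.2 * rot v * rep.2⁻¹)) *
      ((u : ℂ) ^ p * (starRingEnd ℂ) ((v : ℂ) ^ q)) ∂haarCircle ∂haarCircle

/-- **THE ADAPTED DATA**: the adapted pair over `E` with its global invariant in `K`, the data of every place and the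
support clauses, the finite factors and the spectral side. Every field is a hypothesis about the real objects
(TYPING-CENSUS T7); none is proved here. -/
structure AdaptedData (E K : Type) [Field E] [Field K] [NumberField K] [Algebra K E]
    (Rep Orb : Type) [DecidableEq Orb] (PA PB : Rep → Prop) where
  /-- the involution of `E` -/
  σ : E →+* E
  /-- the first orthogonal basis: discriminants `d i` -/
  d : Fin 2 → E
  /-- the second orthogonal basis -/
  f : Fin 2 → Fin 2 → E
  /-- the adapted matrices of the double cosets -/
  matO : Orb → Matrix (Fin 2) (Fin 2) E
  /-- the global invariant, descended to `K` (`KappaDescent`) -/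
  κF : Orb → K
  hκF : ∀ γ, algebraMap K E (κF γ) = kappa σ d f (matO γ)
  /-- the matrices are isometries of the adapted form -/
  hiso : ∀ γ, IsIsom σ d (matO γ)
  /-- `κF` separates the double cosets (`Orb` = the regular cosets; p1's rows 662/663) -/
  hκ : Function.Injective κF
  /-- the dominant double coset -/
  γ₀ : Orb
  /-- the level-`N` support -/
  arith : ℕ → Orb → Prop
  /-- the place where the level shrinks -/
  v₁ : FinitePlace K
  /-- the finite places with bounded denominators -/
  S : Finset (FinitePlace K)
  hv₁S : v₁ ∉ S
  /-- the residue-size parameter at `v₁` -/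
  q : ℝ
  hq : 1 < q
  /-- the two absolute values of `E` above each finite place of `K`, conjugate under `σ` (equal at a non-split place) -/
  abv : FinitePlace K → AbsoluteValue E ℝ
  abv' : FinitePlace K → AbsoluteValue E ℝ
  habv : ∀ (w : FinitePlace K) (x : K), w x = abv w (algebraMap K E x)
  hna : ∀ w, IsNonarchimedean (abv w)
  hna' : ∀ w, IsNonarchimedean (abv' w)
  hσ' : ∀ w x, abv w (σ x) = abv' w x
  /-- integrality of the adapted data at the places off `S`, at both absolute values -/
  hf_int : ∀ w, w ∉ S → (∀ i, abv w (f 0 i) ≤ 1) ∧ ∀ i, abv' w (f 0 i) ≤ 1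
  hd_int : ∀ w, w ∉ S → abv w (d 0) ≤ 1 ∧ abv' w (d 0) ≤ 1
  hdisc_unit : ∀ w, w ∉ S → abv w (d 0 * disc' σ d f 0) = 1
  hγ₀_int : ∀ w, w ∉ S → (∀ i j, abv w (matO γ₀ i j) ≤ 1) ∧ ∀ i j, abv' w (matO γ₀ i j) ≤ 1
  /-- the matrices on the support are integral at the places off `S ∪ {v₁}` -/
  hsupp_int : ∀ w, w ∉ S → w ≠ v₁ → ∀ N γ, arith N γ →
    (∀ i j, abv w (matO γ i j) ≤ 1) ∧ ∀ i j, abv' w (matO γ i j) ≤ 1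
  /-- the entry bounds at the places of `S` -/
  M : FinitePlace K → ℝ
  hM : ∀ w ∈ S, 0 < M w
  hf_S : ∀ w ∈ S, (∀ i, abv w (f 0 i) ≤ M w) ∧ ∀ i, abv' w (f 0 i) ≤ M w
  hd_S : ∀ w ∈ S, abv w (d 0) ≤ M w ∧ abv' w (d 0) ≤ M w
  hγ₀_S : ∀ w ∈ S, (∀ i j, abv w (matO γ₀ i j) ≤ M w) ∧ ∀ i j, abv' w (matO γ₀ i j) ≤ M w
  hsupp_S : ∀ w ∈ S, ∀ N γ, arith N γ → (∀ i j, abv w (matO γ i j) ≤ M w) ∧ ∀ i j, abv' w (matO γ i j) ≤ M w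
  hdisc_S : ∀ w ∈ S, abv w (d 0 * disc' σ d f 0) ≠ 0
  /-- the level-`N` congruence at `v₁` on the support: `matO γ = matO γ₀ · k`, `k ≡ 1 mod q⁻¹ ^ N` at both absolute values -/
  hsupp_cong : ∀ N γ, arith N γ → ∃ k : Matrix (Fin 2) (Fin 2) E, matO γ = matO γ₀ * k ∧
    (∀ i j, abv v₁ ((k - 1) i j) ≤ q⁻¹ ^ N) ∧ ∀ i j, abv' v₁ ((k - 1) i j) ≤ q⁻¹ ^ N
  /-- `K` is totally real -/
  hK : ∀ w : InfinitePlace K, w.IsReal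
  /-- the two rank-one places -/
  w₂ : InfinitePlace K
  w₃ : InfinitePlace K
  hw : w₂ ≠ w₃
  /-- an extension of each real embedding to `E`, intertwining the involutions -/
  ψ : InfinitePlace K → (E →+* ℂ)
  hψσ : ∀ w x, ψ w (σ x) = (starRingEnd ℂ) (ψ w x)
  hψK : ∀ w x, ψ w (algebraMap K E x) = w.embedding x
  /-- the real discriminants at each place -/
  r : InfinitePlace K → Fin 2 → ℝ
  s : InfinitePlace K → Fin 2 → ℝ
  hdr : ∀ w i, ψ w (d i) = (r w i : ℂ)
  /-- the signature `(1, 1)` at the two rank-one places -/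
  D₂ : Sig11Data (r w₂) (s w₂) (fun j i => ψ w₂ (f j i))
  D₃ : Sig11Data (r w₃) (s w₃) (fun j i => ψ w₃ (f j i))
  /-- the signature `(2, 0)` at every other place -/
  D₁ : ∀ w, w ≠ w₂ → w ≠ w₃ → Sig20Data (r w) (s w) (fun j i => ψ w (f j i))
  /-- the archimedean weight and the `K`-type / character indices of the model orbital integral -/
  k : ℕ
  hk : 3 ≤ k
  j : ℕ
  n : ℕ
  p : ℤ
  qq : ℤ
  /-- the compact-place factor, bounded -/
  a₁ : Orb → ℂ
  C₁ : ℝ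
  ha₁ : ∀ γ, ‖a₁ γ‖ ≤ C₁
  /-- the finite-place factor at level `N` -/
  b : ℕ → Orb → ℂ
  b_support : ∀ N γ, b N γ ≠ 0 → arith N γ
  ε : ℝ
  hε : 0 < ε
  hε' : ε < 1 / 4
  b_bound : ∃ Bb : ℝ, ∀ N γ, arith N γ → ‖b N γ‖ ≤ Bb * (1 + size w₂ w₃ κF (κF γ₀) γ) ^ ε * ‖b N γ₀‖
  b_γ₀ : ∃ N₀ : ℕ, ∀ N ≥ N₀, b N γ₀ ≠ 0
  /-- the spectral side -/
  spec : ℕ → Rep → ℂ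
  spec_zero_A : ∀ N π, ¬ PA π → spec N π = 0
  spec_zero_B : ∀ N π, ¬ PB π → spec N π = 0

namespace AdaptedData

variable {E K : Type} [Field E] [Field K] [NumberField K] [Algebra K E]
  {Rep Orb : Type} [DecidableEq Orb] {PA PB : Rep → Prop}
  [MeasurableSpace Circle] [BorelSpace Circle] (A : AdaptedData E K Rep Orb PA PB)

/-- the decay of the model orbital integral at a rank-one place, for SOME representing pair
(`KappaDataArch.exists_archFactor_decay_of_sig11`). -/
theorem exists_rep_decay {w : InfinitePlace K} (D : Sig11Data (A.r w) (A.s w) (fun j i => A.ψ w (A.f j i))) :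
    ∃ rep : Orb → SU11 × SU11, ∀ γ, ‖modelOrbital A.k A.j A.n A.p A.qq (rep γ)‖ ≤
      decayConst A.k A.j A.n * monomialNormSq A.k A.n * reAt (A.hK w) (A.κF γ) ^ (-(A.k : ℝ) / 2) :=
  exists_archFactor_decay_of_sig11 A.σ (A.ψ w) A.d A.f A.matO A.κF (A.hK w) (A.hψσ w) (A.hψK w) (A.hdr w) D
    A.hiso A.hκF A.k A.j A.n (by linarith [A.hk]) A.p A.qq

/-- the representing pairs at `w₂` -/
noncomputable def rep₂ : Orb → SU11 × SU11 := Classical.choose (A.exists_rep_decay A.D₂)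

/-- the representing pairs at `w₃` -/
noncomputable def rep₃ : Orb → SU11 × SU11 := Classical.choose (A.exists_rep_decay A.D₃)

/-- the archimedean factor at `w₂`: the model orbital integral at `rep₂` -/
noncomputable def archFactor₂ (γ : Orb) : ℂ := modelOrbital A.k A.j A.n A.p A.qq (A.rep₂ γ)

/-- the archimedean factor at `w₃`: the model orbital integral at `rep₃` -/
noncomputable def archFactor₃ (γ : Orb) : ℂ := modelOrbital A.k A.j A.n A.p A.qq (A.rep₃ γ)

/-- the decay constant (made non-negative) -/
noncomputable def decayC : ℝ := |decayConst A.k A.j A.n * monomialNormSq A.k A.n|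

/-- the decay of `archFactor₂` in the real value of `κF` at `w₂`, exponent `k/2` -/
theorem norm_archFactor₂_le (γ : Orb) :
    ‖A.archFactor₂ γ‖ ≤ A.decayC * reAt (A.hK A.w₂) (A.κF γ) ^ (-((A.k : ℝ) / 2)) := by
  have h := Classical.choose_spec (A.exists_rep_decay A.D₂) γ
  rw [show (-((A.k : ℝ) / 2)) = -(A.k : ℝ) / 2 from (neg_div _ _).symm]
  refine h.trans (mul_le_mul_of_nonneg_right (le_abs_self _) (Real.rpow_nonneg ?_ _))
  exact zero_le_one.trans (one_le_reAt_of_sig11 A.σ (A.ψ A.w₂) A.d A.f A.matO A.κF (A.hK A.w₂) (A.hψσ A.w₂)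
    (A.hψK A.w₂) (A.hdr A.w₂) A.D₂ A.hiso A.hκF γ)

/-- the decay of `archFactor₃` in the real value of `κF` at `w₃`, exponent `k/2` -/
theorem norm_archFactor₃_le (γ : Orb) :
    ‖A.archFactor₃ γ‖ ≤ A.decayC * reAt (A.hK A.w₃) (A.κF γ) ^ (-((A.k : ℝ) / 2)) := by
  have h := Classical.choose_spec (A.exists_rep_decay A.D₃) γ
  rw [show (-((A.k : ℝ) / 2)) = -(A.k : ℝ) / 2 from (neg_div _ _).symm]
  refine h.trans (mul_le_mul_of_nonneg_right (le_abs_self _) (Real.rpow_nonneg ?_ _))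
  exact zero_le_one.trans (one_le_reAt_of_sig11 A.σ (A.ψ A.w₃) A.d A.f A.matO A.κF (A.hK A.w₃) (A.hψσ A.w₃)
    (A.hψK A.w₃) (A.hdr A.w₃) A.D₃ A.hiso A.hκF γ)

/-- the denominator bounds at the places of `S`: `M w ^ 3 · M w ^ 3 / |d₀ d′₀|_w` -/
noncomputable def B (w : FinitePlace K) : ℝ := A.M w ^ 3 * A.M w ^ 3 / A.abv w (A.d 0 * disc' A.σ A.d A.f 0)

omit [MeasurableSpace Circle] [BorelSpace Circle] in
/-- the denominator bounds are positive -/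
theorem B_pos (w : FinitePlace K) (hw : w ∈ A.S) : 0 < A.B w := by
  unfold B
  have h0 : 0 < A.abv w (A.d 0 * disc' A.σ A.d A.f 0) :=
    lt_of_le_of_ne ((A.abv w).nonneg _) (Ne.symm (A.hdisc_S w hw))
  have hM := A.hM w hw
  positivity

/-- **`KappaData` FROM THE ADAPTED DATA**: every dictionary field derived from the place data (KappaDataArch /
KappaDataFin); the non-vanishing of the dominant archimedean value and the trace identity are hypotheses about the
DEFINED factors `archFactor₂ / archFactor₃`. -/
noncomputable def kappaData
    (ha_γ₀ : A.a₁ A.γ₀ * A.archFactor₂ A.γ₀ * A.archFactor₃ A.γ₀ ≠ 0)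
    (hident : ∀ N, ∑' γ, A.a₁ γ * A.archFactor₂ γ * A.archFactor₃ γ * A.b N γ = ∑' π, A.spec N π) :
    KappaData K Rep Orb PA PB where
  κ := A.κF
  hκ := A.hκ
  γ₀ := A.γ₀
  arith := A.arith
  v₁ := A.v₁
  S := A.S
  hv₁S := A.hv₁S
  q := A.q
  hq := A.hq
  B := A.B
  hBpos := A.B_pos
  hcong := hcong_field_split A.σ (A.abv A.v₁) (A.abv' A.v₁) A.d A.f A.matO A.κF A.v₁ A.arith A.γ₀ (A.habv A.v₁) A.hκF
    (A.hna A.v₁) (A.hna' A.v₁) (A.hσ' A.v₁) (A.hf_int A.v₁ A.hv₁S).1 (A.hd_int A.v₁ A.hv₁S).1 (A.hf_int A.v₁ A.hv₁S).2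
    (A.hd_int A.v₁ A.hv₁S).2 (A.hdisc_unit A.v₁ A.hv₁S) A.hq (A.hγ₀_int A.v₁ A.hv₁S).1 (A.hγ₀_int A.v₁ A.hv₁S).2
    A.hsupp_cong
  hS := fun N γ hγ w hw => hS_field_split A.σ (A.abv w) (A.abv' w) A.d A.f A.matO A.κF w A.arith A.γ₀ (A.habv w) A.hκF
    (A.hna w) (A.hna' w) (A.hσ' w) (A.hM w hw).le (A.hM w hw).le (A.hf_S w hw).1 (A.hd_S w hw).1 (A.hf_S w hw).2
    (A.hd_S w hw).2 (A.hγ₀_S w hw).1 (A.hγ₀_S w hw).2 (A.hsupp_S w hw) N γ hγ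
  hout := fun N γ hγ w hwS hwv => hout_field_split A.σ (A.abv w) (A.abv' w) A.d A.f A.matO A.κF w A.arith A.γ₀
    (A.habv w) A.hκF (A.hna w) (A.hna' w) (A.hσ' w) (A.hf_int w hwS).1 (A.hd_int w hwS).1 (A.hf_int w hwS).2
    (A.hd_int w hwS).2 (A.hdisc_unit w hwS) (A.hγ₀_int w hwS).1 (A.hγ₀_int w hwS).2 (A.hsupp_int w hwS hwv) N γ hγ
  hK := A.hK
  w₂ := A.w₂
  w₃ := A.w₃
  hw := A.hw
  Binf := 1
  hBinf := one_pos
  hT := fun _ γ _ w h₂ h₃ => place_sub_le_one_of_sig20 A.σ (A.ψ w) A.d A.f A.matO A.κF (A.hψσ w)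
    (A.hψK w) (A.hdr w) (A.D₁ w h₂ h₃) A.hiso A.hκF γ A.γ₀
  a₁ := A.a₁
  a₂ := A.archFactor₂
  a₃ := A.archFactor₃
  C₁ := A.C₁
  ha₁ := A.ha₁
  one_le_κ₂ := fun γ => one_le_reAt_of_sig11 A.σ (A.ψ A.w₂) A.d A.f A.matO A.κF (A.hK A.w₂) (A.hψσ A.w₂)
    (A.hψK A.w₂) (A.hdr A.w₂) A.D₂ A.hiso A.hκF γ
  one_le_κ₃ := fun γ => one_le_reAt_of_sig11 A.σ (A.ψ A.w₃) A.d A.f A.matO A.κF (A.hK A.w₃) (A.hψσ A.w₃)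
    (A.hψK A.w₃) (A.hdr A.w₃) A.D₃ A.hiso A.hκF γ
  k₂ := A.k
  k₃ := A.k
  hk₂ := A.hk
  hk₃ := A.hk
  C₂ := A.decayC
  C₃ := A.decayC
  hC₂ := abs_nonneg _
  hC₃ := abs_nonneg _
  ha₂ := A.norm_archFactor₂_le
  ha₃ := A.norm_archFactor₃_le
  a_γ₀ := ha_γ₀
  ε := A.ε
  hε := A.hε
  hε' := A.hε'
  b := A.b
  b_support := A.b_support
  b_bound := A.b_bound
  b_γ₀ := A.b_γ₀
  spec := A.spec
  spec_zero_A := A.spec_zero_A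
  spec_zero_B := A.spec_zero_B
  identity := hident

/-- **the two-period conclusion from the adapted data**. -/
theorem exists_twoTorus
    (ha_γ₀ : A.a₁ A.γ₀ * A.archFactor₂ A.γ₀ * A.archFactor₃ A.γ₀ ≠ 0)
    (hident : ∀ N, ∑' γ, A.a₁ γ * A.archFactor₂ γ * A.archFactor₃ γ * A.b N γ = ∑' π, A.spec N π) :
    ∃ π, PA π ∧ PB π :=
  KappaData.exists_twoTorus_of_kappaData (A.kappaData ha_γ₀ hident)

end AdaptedData

end Summit.Ventures.HodgeRepro2.Tier7.Line3.KappaDataOfAdapted
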